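import Summits.FinalStateConjecture.FinalStateConjecture.Theorems.EIHFluxBalanceInertialRecessionVirialVisitImpulse
import Summits.FinalStateConjecture.FinalStateConjecture.Theorems.EIHFluxBalanceInertialRecessionVirialVisitCalc
import Mathlib.Analysis.InnerProductSpace.Calculus

/-!
# Route EIHFluxBalance — crux `InertialRecession`, abstract endgame for general `N`:
# the FLY-BY lemma (toward LEMMA SPLIT, visits, block L4)

Helper file for the crux `stmt-FinalStateConjecture-10166` (virial route, `work/split/PLAN.md`, N = 3 doubly-bad case).
Mathlib-only. Two bodies `a, c` whose mutual distance `d = ‖ξ_c − ξ_a‖` stays `≥ r_m` on `[j₁, j₂]`, with every other body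
beyond `d/2` from both, single-body windows of radius `d/3` admissible (threshold `ρ ≤ d/6`, cone), slaving errors `≤ Fe₀` and
identification errors `≤ Z` there. If the relative velocity `u = v_c − v_a` is FAST at `j₁` (`U = ‖u(j₁)‖` with
`2Fe₀ ≤ U/8` and the kick budget `(6/M_a + 6/M_c)(|C|·3^{3/2}·6 r_m^{-1/2}/(3U/4) + 2Z) ≤ U/16`) then on the whole interval the
relative velocity stays within `U/8` of `u(j₁)` and `v_a` moves by at most the kick `6(|C|·3^{3/2}·6r_m^{-1/2}/(3U/4) + 2Z)/M_a`
(`flyby`). Proof: continuous induction; while `u` is `U/8`-close, the coordinate of `ξ_c − ξ_a` along `u(j₁)` advances at rate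
`≥ 3U/4`, so `d ≥ max(r_m, (3U/4)|s − m|)` for one time `m`, the window budget is `≤ 3^{3/2}·6r_m^{-1/2}/(3U/4)`
(`integral_inv_rpow_max_le`) and both velocity increments are small (`velocity_increment_of_windowPath`).
-/

noncomputable section

open Finset Filter Topology MeasureTheory intervalIntegral Set

namespace Summit.FinalStateConjecture.FinalStateConjecture.Theorems.SublinearIsFree.Virial

open Literature.Geometry.Lorentzian

variable {N : ℕ}

/-- A real function on `[a, b]` increasing at rate `≥ C > 0` stays at distance `≥ C|s − m|` from `0` for one `m ∈ [a, b]`.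
[folklore] -/
theorem exists_abs_ge_mul_abs_sub {x : ℝ → ℝ} {a b C : ℝ} (hab : a ≤ b) (hC : 0 < C) (hx : ContinuousOn x (Icc a b))
    (hrate : ∀ s ∈ Icc a b, ∀ s' ∈ Icc a b, s ≤ s' → C * (s' - s) ≤ x s' - x s) :
    ∃ m ∈ Icc a b, ∀ s ∈ Icc a b, C * |s - m| ≤ |x s| := by
  by_cases ha : 0 ≤ x a
  · refine ⟨a, left_mem_Icc.mpr hab, fun s hs ↦ ?_⟩
    have h := hrate a (left_mem_Icc.mpr hab) s hs hs.1
    rw [abs_of_nonneg (by linarith [hs.1]), abs_of_nonneg (by nlinarith [hs.1])]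
    linarith
  by_cases hb : x b ≤ 0
  · refine ⟨b, right_mem_Icc.mpr hab, fun s hs ↦ ?_⟩
    have h := hrate s hs b (right_mem_Icc.mpr hab) hs.2
    rw [abs_of_nonpos (by linarith [hs.2]), abs_of_nonpos (by nlinarith [hs.2])]
    linarith
  push Not at ha hb
  obtain ⟨m, hm, hxm⟩ : ∃ m ∈ Icc a b, x m = 0 :=
    intermediate_value_Icc hab hx ⟨ha.le, hb.le⟩
  refine ⟨m, hm, fun s hs ↦ ?_⟩
  rcases le_total s m with h | h
  · have h1 := hrate s hs m hm h
    rw [hxm] at h1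
    rw [abs_of_nonpos (by linarith), abs_of_nonpos (by nlinarith)]
    linarith
  · have h1 := hrate m hm s hs h
    rw [hxm] at h1
    rw [abs_of_nonneg (by linarith), abs_of_nonneg (by nlinarith)]
    linarith

/-- **The fly-by lemma** (see the module docstring). [folklore] -/
theorem flyby (M : Fin N → ℝ) (ξ v : Fin N → ℝ → E3) (κ : ℝ) (P : ℝ → E3 → ℝ → Fin 4 → ℝ)
    (ρ : ℝ → ℝ) (C T T' T₀ : ℝ) (ζ : ℝ → ℝ)
    (hWL : ∀ (t₁ t₂ : ℝ) (c : ℝ → E3) (R : ℝ → ℝ), T ≤ t₁ → t₁ ≤ t₂ →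
      (∀ s ∈ Set.Icc t₁ t₂, ∀ s' ∈ Set.Icc t₁ t₂, ‖c s - c s'‖ ≤ 2 * |s - s'| ∧ |R s - R s'| ≤ 2 * |s - s'|) →
      (∀ s ∈ Set.Icc t₁ t₂, ρ s ≤ (1 / 2) * R s ∧ ‖c s‖ + R s ≤ (κ + κ ^ 2) / 2 * s ∧
        ∀ j, ‖ξ j s - c s‖ ≤ (1 - 1 / 2) * R s ∨ (1 + 1 / 2) * R s ≤ ‖ξ j s - c s‖) →
      ∀ μ : Fin 4, |P t₂ (c t₂) (R t₂) μ - P t₁ (c t₁) (R t₁) μ| ≤ C * ∫ s in t₁..t₂, (R s ^ (3 / 2 : ℝ))⁻¹)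
    (hID : ∀ (t : ℝ) (c : E3) (R : ℝ) (A : Finset (Fin N)), T' ≤ t → ρ t ≤ (1 / 2) * R →
      ‖c‖ + R ≤ (κ + κ ^ 2) / 2 * t →
      (∀ j, ‖ξ j t - c‖ ≤ (1 - 1 / 2) * R ∨ (1 + 1 / 2) * R ≤ ‖ξ j t - c‖) →
      (∀ j, j ∈ A ↔ ‖ξ j t - c‖ ≤ (1 - 1 / 2) * R) →
      |P t c R 0 - ∑ j ∈ A, M j * (√(1 - ‖v j t‖ ^ 2))⁻¹| ≤ ζ t ∧
      ∀ k : Fin 3, |P t c R k.succ - ∑ j ∈ A, M j * (√(1 - ‖v j t‖ ^ 2))⁻¹ * v j t k| ≤ ζ t)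
    (hdiff : ∀ i, Differentiable ℝ (ξ i)) (hspeed : ∀ i s, T₀ ≤ s → ‖deriv (ξ i) s‖ ≤ 2) (hvcont : ∀ i, Continuous (v i))
    {a c : Fin N} (hMa : 0 < M a) (hMc : 0 < M c) (hv1 : ∀ x t, ‖v x t‖ < 1)
    {j₁ j₂ rm Fe₀ Z : ℝ} (hT : T ≤ j₁) (hT' : T' ≤ j₁) (hT₀ : T₀ ≤ j₁) (h12 : j₁ ≤ j₂) (hrm : 0 < rm)
    (hrmd : ∀ s ∈ Icc j₁ j₂, rm ≤ ‖ξ c s - ξ a s‖)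
    (hρ : ∀ s ∈ Icc j₁ j₂, ρ s ≤ ‖ξ c s - ξ a s‖ / 6)
    (hcapa : ∀ s ∈ Icc j₁ j₂, ‖ξ a s‖ + ‖ξ c s - ξ a s‖ / 3 ≤ (κ + κ ^ 2) / 2 * s)
    (hcapc : ∀ s ∈ Icc j₁ j₂, ‖ξ c s‖ + ‖ξ c s - ξ a s‖ / 3 ≤ (κ + κ ^ 2) / 2 * s)
    (hothers : ∀ s ∈ Icc j₁ j₂, ∀ y, y ≠ a → y ≠ c →
      ‖ξ c s - ξ a s‖ / 2 ≤ ‖ξ y s - ξ a s‖ ∧ ‖ξ c s - ξ a s‖ / 2 ≤ ‖ξ y s - ξ c s‖)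
    (hsl : ∀ s ∈ Icc j₁ j₂, ‖deriv (ξ a) s - v a s‖ ≤ Fe₀ ∧ ‖deriv (ξ c) s - v c s‖ ≤ Fe₀)
    (hζZ : ∀ s ∈ Icc j₁ j₂, ζ s ≤ Z) (hZ : 0 ≤ Z)
    (hUpos : 0 < ‖v c j₁ - v a j₁‖) (hFe : 2 * Fe₀ ≤ ‖v c j₁ - v a j₁‖ / 8)
    (hkick : (6 / M a + 6 / M c) *
      (|C| * ((3 : ℝ) ^ (3 / 2 : ℝ) * (6 * (rm ^ (1 / 2 : ℝ))⁻¹ / (3 * ‖v c j₁ - v a j₁‖ / 4))) + 2 * Z) ≤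
        ‖v c j₁ - v a j₁‖ / 16) :
    (∀ s ∈ Icc j₁ j₂, ‖(v c s - v a s) - (v c j₁ - v a j₁)‖ ≤ ‖v c j₁ - v a j₁‖ / 8) ∧
    ∀ s ∈ Icc j₁ j₂, ‖v a s - v a j₁‖ ≤
      6 * (|C| * ((3 : ℝ) ^ (3 / 2 : ℝ) * (6 * (rm ^ (1 / 2 : ℝ))⁻¹ / (3 * ‖v c j₁ - v a j₁‖ / 4))) + 2 * Z) / M a := by
  -- notation
  obtain ⟨u₀, hu₀⟩ : ∃ u₀ : E3, u₀ = v c j₁ - v a j₁ := ⟨_, rfl⟩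
  obtain ⟨U, hU⟩ : ∃ U : ℝ, U = ‖v c j₁ - v a j₁‖ := ⟨_, rfl⟩
  rw [← hU] at hUpos hFe hkick ⊢
  rw [← hu₀]
  have hUu : ‖u₀‖ = U := by rw [hu₀, hU]
  obtain ⟨bud, hbud⟩ : ∃ bud : ℝ, bud = (3 : ℝ) ^ (3 / 2 : ℝ) * (6 * (rm ^ (1 / 2 : ℝ))⁻¹ / (3 * U / 4)) := ⟨_, rfl⟩
  rw [← hbud] at hkick ⊢
  have hbud0 : 0 ≤ bud := by rw [hbud]; positivity
  obtain ⟨kick, hkickdef⟩ : ∃ k : ℝ, k = |C| * bud + 2 * Z := ⟨_, rfl⟩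
  rw [← hkickdef] at hkick ⊢
  have hkick0 : 0 ≤ kick := by rw [hkickdef]; positivity
  -- the relative position and its derivative
  obtain ⟨r, hrdef⟩ : ∃ r : ℝ → E3, r = fun s ↦ ξ c s - ξ a s := ⟨_, rfl⟩
  have hrap : ∀ s, r s = ξ c s - ξ a s := fun s ↦ by rw [hrdef]
  have hrd : Differentiable ℝ r := by rw [hrdef]; exact (hdiff c).sub (hdiff a)
  have hrder : ∀ s, deriv r s = deriv (ξ c) s - deriv (ξ a) s := fun s ↦ by
    rw [hrdef]; exact deriv_sub (hdiff c s) (hdiff a s)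
  have hj0' : ∀ s ∈ Icc j₁ j₂, T₀ ≤ s := fun s hs ↦ hT₀.trans hs.1
  -- the radius `d/3` is 2-Lipschitz and the windows are admissible
  have hlip2 : ∀ i, ∀ s ∈ Icc j₁ j₂, ∀ s' ∈ Icc j₁ j₂, ‖ξ i s - ξ i s'‖ ≤ 2 * |s - s'| := fun i s hs s' hs' ↦
    Endgame.lipschitz_two_of_deriv (hdiff i) (fun t ht ↦ hspeed i t ht) (hj0' s hs) (hj0' s' hs')
  have hRlip : ∀ s ∈ Icc j₁ j₂, ∀ s' ∈ Icc j₁ j₂, |‖ξ c s - ξ a s‖ / 3 - ‖ξ c s' - ξ a s'‖ / 3| ≤ 2 * |s - s'| := by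
    intro s hs s' hs'
    have h1 : |‖ξ c s - ξ a s‖ - ‖ξ c s' - ξ a s'‖| ≤ ‖(ξ c s - ξ a s) - (ξ c s' - ξ a s')‖ := abs_norm_sub_norm_le _ _
    have h2 : ‖(ξ c s - ξ a s) - (ξ c s' - ξ a s')‖ ≤ ‖ξ c s - ξ c s'‖ + ‖ξ a s - ξ a s'‖ := by
      calc ‖(ξ c s - ξ a s) - (ξ c s' - ξ a s')‖ = ‖(ξ c s - ξ c s') - (ξ a s - ξ a s')‖ := by congr 1; abel
        _ ≤ ‖ξ c s - ξ c s'‖ + ‖ξ a s - ξ a s'‖ := norm_sub_le _ _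
    have h3 := hlip2 c s hs s' hs'
    have h4 := hlip2 a s hs s' hs'
    rw [← sub_div, abs_div, abs_of_pos (by norm_num : (0 : ℝ) < 3)]
    rw [div_le_iff₀ (by norm_num : (0 : ℝ) < 3)]
    linarith [abs_nonneg (s - s')]
  -- THE KEY STEP: if `u` is `U/8`-close to `u₀` on `[j₁, s]` then the budget on `[j₁, s]` is `≤ bud`
  have key : ∀ s ∈ Icc j₁ j₂, (∀ s' ∈ Icc j₁ s, ‖(v c s' - v a s') - u₀‖ ≤ U / 8) →
      (∫ s' in j₁..s, ((‖ξ c s' - ξ a s'‖ / 3) ^ (3 / 2 : ℝ))⁻¹) ≤ bud := by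
    intro s hs hclose
    have hj₁s : j₁ ≤ s := hs.1
    -- the derivative of `r` is `U/4`-close to `u₀`
    have hder : ∀ s' ∈ Icc j₁ s, ‖deriv r s' - u₀‖ ≤ U / 4 := by
      intro s' hs'
      have hs'' : s' ∈ Icc j₁ j₂ := ⟨hs'.1, hs'.2.trans hs.2⟩
      have h1 := hclose s' hs'
      have h2 := hsl s' hs''
      calc ‖deriv r s' - u₀‖
          = ‖(deriv (ξ c) s' - v c s') - (deriv (ξ a) s' - v a s') + ((v c s' - v a s') - u₀)‖ := by
            rw [hrder]; congr 1; abel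
        _ ≤ ‖deriv (ξ c) s' - v c s'‖ + ‖deriv (ξ a) s' - v a s'‖ + ‖(v c s' - v a s') - u₀‖ :=
            (norm_add_le _ _).trans (add_le_add (norm_sub_le _ _) le_rfl)
        _ ≤ U / 4 := by linarith [h2.1, h2.2]
    -- the coordinate along `u₀` advances at rate `≥ 3U/4`
    obtain ⟨e, hedef⟩ : ∃ e : E3, e = U⁻¹ • u₀ := ⟨_, rfl⟩
    have he1 : ‖e‖ = 1 := by rw [hedef, norm_smul, Real.norm_eq_abs, abs_of_pos (inv_pos.mpr hUpos), hUu, inv_mul_cancel₀ hUpos.ne']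
    have heu : inner ℝ u₀ e = U := by
      rw [hedef, real_inner_smul_right, real_inner_self_eq_norm_sq, hUu]; field_simp
    obtain ⟨x, hxdef⟩ : ∃ x : ℝ → ℝ, x = fun t ↦ inner ℝ (r t) e := ⟨_, rfl⟩
    have hxder : ∀ t, HasDerivAt x (inner ℝ (deriv r t) e) t := fun t ↦ by
      rw [hxdef]
      have h := (hrd t).hasDerivAt.inner (𝕜 := ℝ) (hasDerivAt_const t e)
      simpa using h
    have hrc' : Continuous r := hrd.continuous
    have hxcont : Continuous x := by rw [hxdef]; fun_prop
    have hxrate : ∀ t ∈ Icc j₁ s, 3 * U / 4 ≤ deriv x t := fun t ht ↦ by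
      rw [(hxder t).deriv]
      have h1 : inner ℝ (deriv r t) e = U + inner ℝ (deriv r t - u₀) e := by
        rw [inner_sub_left, heu]; ring
      have h2 : |inner ℝ (deriv r t - u₀) e| ≤ ‖deriv r t - u₀‖ * ‖e‖ := abs_real_inner_le_norm _ _
      rw [he1, mul_one] at h2
      have h3 := hder t ht
      have h4 := neg_abs_le (inner ℝ (deriv r t - u₀) e)
      linarith
    have hmono : ∀ t ∈ Icc j₁ s, ∀ t' ∈ Icc j₁ s, t ≤ t' → 3 * U / 4 * (t' - t) ≤ x t' - x t :=
      (convex_Icc j₁ s).mul_sub_le_image_sub_of_le_deriv hxcont.continuousOn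
        (fun t _ ↦ (hxder t).differentiableAt.differentiableWithinAt)
        (fun t ht ↦ hxrate t (interior_subset ht))
    obtain ⟨m, -, hm⟩ := exists_abs_ge_mul_abs_sub hj₁s (by positivity : 0 < 3 * U / 4) hxcont.continuousOn hmono
    -- hence `d ≥ max(rm, (3U/4)|t - m|)` and the pointwise budget bound
    have hdlow : ∀ t ∈ Icc j₁ s, max rm (3 * U / 4 * |t - m|) ≤ ‖ξ c t - ξ a t‖ := fun t ht ↦ by
      refine max_le (hrmd t ⟨ht.1, ht.2.trans hs.2⟩) ((hm t ht).trans ?_)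
      have h1 : |x t| ≤ ‖r t‖ * ‖e‖ := by rw [hxdef]; exact abs_real_inner_le_norm _ _
      rwa [he1, mul_one, hrap] at h1
    have hpt : ∀ t ∈ Icc j₁ s, ((‖ξ c t - ξ a t‖ / 3) ^ (3 / 2 : ℝ))⁻¹ ≤
        (3 : ℝ) ^ (3 / 2 : ℝ) * ((max rm (3 * U / 4 * |t - m|)) ^ (3 / 2 : ℝ))⁻¹ := fun t ht ↦ by
      have hmax0 : 0 < max rm (3 * U / 4 * |t - m|) := hrm.trans_le (le_max_left _ _)
      have h1 := hdlow t ht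
      have h2 : ((‖ξ c t - ξ a t‖ / 3) ^ (3 / 2 : ℝ))⁻¹ ≤ ((max rm (3 * U / 4 * |t - m|) / 3) ^ (3 / 2 : ℝ))⁻¹ :=
        inv_anti₀ (Real.rpow_pos_of_pos (div_pos hmax0 (by norm_num)) _)
          (Real.rpow_le_rpow (div_pos hmax0 (by norm_num)).le (by linarith) (by norm_num))
      have h3 : ((max rm (3 * U / 4 * |t - m|) / 3) ^ (3 / 2 : ℝ))⁻¹ =
          (3 : ℝ) ^ (3 / 2 : ℝ) * ((max rm (3 * U / 4 * |t - m|)) ^ (3 / 2 : ℝ))⁻¹ := by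
        rw [Real.div_rpow hmax0.le (by norm_num), inv_div, div_eq_mul_inv]
      linarith [h3.le, h3.ge]
    -- integrate
    have hcont1 : ContinuousOn (fun t ↦ ((‖ξ c t - ξ a t‖ / 3) ^ (3 / 2 : ℝ))⁻¹) (Icc j₁ s) := by
      refine ContinuousOn.inv₀ ?_ fun t ht ↦ (Real.rpow_pos_of_pos ?_ _).ne'
      · refine ContinuousOn.rpow_const ?_ fun t ht ↦ Or.inl ?_
        · exact ((((hdiff c).continuous.sub (hdiff a).continuous).norm).div_const 3).continuousOn
        · have hd : 0 < ‖ξ c t - ξ a t‖ := hrm.trans_le (hrmd t ⟨ht.1, ht.2.trans hs.2⟩)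
          positivity
      · have hd : 0 < ‖ξ c t - ξ a t‖ := hrm.trans_le (hrmd t ⟨ht.1, ht.2.trans hs.2⟩)
        positivity
    have hcont2 : ContinuousOn (fun t ↦ (3 : ℝ) ^ (3 / 2 : ℝ) * ((max rm (3 * U / 4 * |t - m|)) ^ (3 / 2 : ℝ))⁻¹)
        (Icc j₁ s) := by
      refine (continuousOn_const.mul (ContinuousOn.inv₀ ?_ fun t _ ↦
        (Real.rpow_pos_of_pos (hrm.trans_le (le_max_left _ _)) _).ne'))
      exact (Continuous.continuousOn (by fun_prop)).rpow_const fun t _ ↦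
        Or.inl (hrm.trans_le (le_max_left _ _)).ne'
    calc ∫ s' in j₁..s, ((‖ξ c s' - ξ a s'‖ / 3) ^ (3 / 2 : ℝ))⁻¹
        ≤ ∫ s' in j₁..s, (3 : ℝ) ^ (3 / 2 : ℝ) * ((max rm (3 * U / 4 * |s' - m|)) ^ (3 / 2 : ℝ))⁻¹ :=
          intervalIntegral.integral_mono_on hj₁s (hcont1.intervalIntegrable_of_Icc hj₁s)
            (hcont2.intervalIntegrable_of_Icc hj₁s) hpt
      _ = (3 : ℝ) ^ (3 / 2 : ℝ) * ∫ s' in j₁..s, ((max rm (3 * U / 4 * |s' - m|)) ^ (3 / 2 : ℝ))⁻¹ :=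
          intervalIntegral.integral_const_mul _ _
      _ ≤ (3 : ℝ) ^ (3 / 2 : ℝ) * (6 * (rm ^ (1 / 2 : ℝ))⁻¹ / (3 * U / 4)) :=
          mul_le_mul_of_nonneg_left (integral_inv_rpow_max_le hrm (by positivity) hj₁s) (by positivity)
      _ = bud := hbud.symm
  -- velocity increments from the key step
  have hinca : ∀ s ∈ Icc j₁ j₂, (∀ s' ∈ Icc j₁ s, ‖(v c s' - v a s') - u₀‖ ≤ U / 8) →
      ‖v a s - v a j₁‖ ≤ 6 * kick / M a ∧ ‖v c s - v c j₁‖ ≤ 6 * kick / M c := by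
    intro s hs hclose
    have hj₁s : j₁ ≤ s := hs.1
    have hsub : ∀ s' ∈ Icc j₁ s, s' ∈ Icc j₁ j₂ := fun s' hs' ↦ ⟨hs'.1, hs'.2.trans hs.2⟩
    have hb := key s hs hclose
    have hint0 : 0 ≤ ∫ s' in j₁..s, ((‖ξ c s' - ξ a s'‖ / 3) ^ (3 / 2 : ℝ))⁻¹ :=
      intervalIntegral.integral_nonneg hj₁s fun s' hs' ↦
        (inv_pos.mpr (Real.rpow_pos_of_pos (div_pos (hrm.trans_le (hrmd s' (hsub s' hs'))) (by norm_num)) _)).le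
    have hCb : C * (∫ s' in j₁..s, ((‖ξ c s' - ξ a s'‖ / 3) ^ (3 / 2 : ℝ))⁻¹) + ζ j₁ + ζ s ≤ kick := by
      rw [hkickdef]
      have h1 : C * (∫ s' in j₁..s, ((‖ξ c s' - ξ a s'‖ / 3) ^ (3 / 2 : ℝ))⁻¹) ≤ |C| * bud :=
        (mul_le_mul_of_nonneg_right (le_abs_self C) hint0).trans (mul_le_mul_of_nonneg_left hb (abs_nonneg C))
      linarith [hζZ j₁ ⟨le_rfl, h12⟩, hζZ s hs]
    constructor
    · have h := velocity_increment_of_windowPath M ξ v κ P ρ C T T' T₀ ζ hWL hID hdiff hspeed hMa (hv1 a)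
        (R := fun t ↦ ‖ξ c t - ξ a t‖ / 3) hT hT' hT₀ hj₁s
        (fun t ht t' ht' ↦ hRlip t (hsub t ht) t' (hsub t' ht'))
        (fun t ht ↦ div_pos (hrm.trans_le (hrmd t (hsub t ht))) (by norm_num))
        (fun t ht ↦ by have := hρ t (hsub t ht); linarith)
        (fun t ht ↦ hcapa t (hsub t ht))
        (fun t ht j hj ↦ by
          by_cases hjc : j = c
          · rw [hjc]
            have := hrmd t (hsub t ht)
            linarith
          · exact le_trans (by linarith) (hothers t (hsub t ht) j hj hjc).1)
      exact h.trans (by rw [div_le_div_iff_of_pos_right hMa]; linarith)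
    · have h := velocity_increment_of_windowPath M ξ v κ P ρ C T T' T₀ ζ hWL hID hdiff hspeed hMc (hv1 c)
        (R := fun t ↦ ‖ξ c t - ξ a t‖ / 3) hT hT' hT₀ hj₁s
        (fun t ht t' ht' ↦ hRlip t (hsub t ht) t' (hsub t' ht'))
        (fun t ht ↦ div_pos (hrm.trans_le (hrmd t (hsub t ht))) (by norm_num))
        (fun t ht ↦ by have := hρ t (hsub t ht); linarith)
        (fun t ht ↦ hcapc t (hsub t ht))
        (fun t ht j hj ↦ by
          by_cases hja : j = a
          · rw [hja]
            have e : ‖ξ a t - ξ c t‖ = ‖ξ c t - ξ a t‖ := norm_sub_rev _ _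
            rw [e]
            linarith [hrmd t (hsub t ht)]
          · exact le_trans (by linarith) (hothers t (hsub t ht) j hja hj).2)
      exact h.trans (by rw [div_le_div_iff_of_pos_right hMc]; linarith)
  -- continuous induction on the closed set `S = {‖u − u₀‖ ≤ U/8}`
  obtain ⟨S, hSdef⟩ : ∃ S : Set ℝ, S = {s | ‖(v c s - v a s) - u₀‖ ≤ U / 8} := ⟨_, rfl⟩
  have hmemS : ∀ s, s ∈ S ↔ ‖(v c s - v a s) - u₀‖ ≤ U / 8 := fun s ↦ by rw [hSdef]; rfl
  have hSc : IsClosed S := by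
    rw [hSdef]
    exact isClosed_le (by fun_prop) continuous_const
  have hj₁S : j₁ ∈ S := by
    rw [hmemS, hu₀, sub_self, norm_zero]; positivity
  have hind : Icc j₁ j₂ ⊆ S := by
    refine (hSc.inter isClosed_Icc).Icc_subset_of_forall_mem_nhdsGT_of_Icc_subset hj₁S fun s hs hsub ↦ ?_
    have hs' : s ∈ Icc j₁ j₂ := ⟨hs.1, hs.2.le⟩
    have hclose : ∀ s' ∈ Icc j₁ s, ‖(v c s' - v a s') - u₀‖ ≤ U / 8 := fun s' hs'' ↦ (hmemS s').mp (hsub hs'')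
    obtain ⟨ha, hc⟩ := hinca s hs' hclose
    have hlt : ‖(v c s - v a s) - u₀‖ < U / 8 := by
      have h1 : ‖(v c s - v a s) - u₀‖ ≤ ‖v c s - v c j₁‖ + ‖v a s - v a j₁‖ := by
        calc ‖(v c s - v a s) - u₀‖ = ‖(v c s - v c j₁) - (v a s - v a j₁)‖ := by rw [hu₀]; congr 1; abel
          _ ≤ ‖v c s - v c j₁‖ + ‖v a s - v a j₁‖ := norm_sub_le _ _
      have h2 : 6 * kick / M a + 6 * kick / M c = (6 / M a + 6 / M c) * kick := by ring
      have h3 : 0 < U / 16 := by positivity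
      linarith
    have hopen : IsOpen {s' : ℝ | ‖(v c s' - v a s') - u₀‖ < U / 8} := isOpen_lt (by fun_prop) continuous_const
    refine mem_nhdsWithin_of_mem_nhds (Filter.mem_of_superset (hopen.mem_nhds hlt) fun s' hs'' ↦ ?_)
    rw [hmemS]; exact le_of_lt hs''
  -- conclusions
  have hcloseAll : ∀ s ∈ Icc j₁ j₂, ∀ s' ∈ Icc j₁ s, ‖(v c s' - v a s') - u₀‖ ≤ U / 8 := fun s hs s' hs' ↦
    (hmemS s').mp (hind ⟨hs'.1, hs'.2.trans hs.2⟩)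
  exact ⟨fun s hs ↦ (hmemS s).mp (hind hs), fun s hs ↦ (hinca s hs (hcloseAll s hs)).1⟩

/-- Registered one-line form of `exists_abs_ge_mul_abs_sub`. [folklore] -/
theorem exists_abs_ge_mul_abs_sub' : open Set in ∀ {x : ℝ → ℝ} {a b C : ℝ}, a ≤ b → 0 < C → ContinuousOn x (Icc a b) → (∀ s ∈ Icc a b, ∀ s' ∈ Icc a b, s ≤ s' → C * (s' - s) ≤ x s' - x s) → ∃ m ∈ Icc a b, ∀ s ∈ Icc a b, C * |s - m| ≤ |x s| :=
  fun hab hC hx hrate ↦ exists_abs_ge_mul_abs_sub hab hC hx hrate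

end Summit.FinalStateConjecture.FinalStateConjecture.Theorems.SublinearIsFree.Virial

end
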